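import Literature.Geometry.DiscreteGeometry.HeitmannRadinPolygon
import HarnessLib

/-!
# A sticky-disc ground state with a centred hexagonal number of discs is a regular hexagon

Topic `Literature/Geometry/DiscreteGeometry`; sequel to `HeitmannRadinStructure.lean`,
`HeitmannRadinBoundaryCount.lean` (Heitmann–Radin 1980, Theorem (2)(a)–(b): every corner of a
maximal configuration is tight or outer, all centres lie on one triangular lattice `t + u(ℤ + ℤζ)`,
the boundary polygon has exactly `⌈√(12n-3)⌉ - 3` vertices) and `HeitmannRadinPolygon.lean`
(arithmetic of the lattice `t + u(ℤ + ℤζ)`).  The result proved here is the hexagonal case of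
the uniqueness question for Heitmann–Radin (sticky disc) ground states [Schmidt2013,
Proposition 2.7; LucaFriesecke2017, Theorem 1.1 (a)]: **a maximal configuration of
`n = 3k(k+1) + 1` unit discs (a hard configuration with `[3n - √(12n-3)] = 9k² + 3k` contact pairs)
is a congruent copy of the lattice hexagon `H_k = {m + nζ : |m|, |n|, |m+n| ≤ k}`** — the
Heitmann–Radin hexagon `H_s` of `HexagonalSpiral.lean` (`HarborthSpiral.hexagon k`).

## Proof (ours — an induction on `k` along Heitmann–Radin's peeling, in place of Schmidt's
## Euler-formula / Wulff-uniqueness argument and De Luca–Friesecke's energy decomposition)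

For `k = 0` there is one disc.  For `k ≥ 1` (`n ≥ 7`) let `S` be the boundary set of the maximal
configuration `P` (`a := #S = ⌈√(12n-3)⌉ - 3 = 6k`, Theorem (2)(b), `card_bdrySet_of_maximal`)
and `P' = P ∖ S` the interior configuration, `#P' = 3(k-1)k + 1` — again a centred hexagonal
number.  Harborth's bookkeeping (`boundary_bookkeeping`) gives `D + D_S = D' + 2σ_S` for the dart
counts `D, D_S, D'` of `P, S, P'` and the boundary degree sum `σ_S`, with `D_S ≥ 2a` (the boundary
cycle) and — every corner being tight or outer — `σ_S = 4a - 6` exactly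
(`sum_card_nbrs_bdrySet_eq_of_tight`); hence
`D' ≥ 2[3n - √(12n-3)] + 2a - 2(4a - 6) = 2(9k² + 3k) - 36k + 12 = 2(9(k-1)² + 3(k-1))`, i.e. the
interior configuration is again MAXIMAL.  By induction (in the lattice frame `t + u(ℤ + ℤζ)` of
`P`, which contains `P'`) `P'` is a translate `c + H_{k-1}` of the smaller hexagon.  Every interior
disc touches exactly six others (`card_nbrs_eq_six_of_tight`), and its six neighbours are lattice
points at distance one, i.e. ALL six lattice neighbours of an interior centre are centres.  So `P`
contains `c + (H_{k-1} + {0, ζ^j})  = c + H_k` (`exists_adj_of_mem_hexagon_succ`: every label of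
`H_k` lies in `H_{k-1}` or next to it), a set of `3k(k+1) + 1 = #P` points: `P = c + H_k`.

## Contents (namespace `Literature.Geometry.DiscreteGeometry.Harborth`)

`framePt t u (m, n) = t + u(m + nζ)` (the frame map of a congruent copy of the lattice) with
`framePt_sub`, `norm_framePt_sub_eq_one_iff` (unit distance ⟺ label adjacency `HarborthSpiral.Adj`),
`framePt_injective`, `framePt_add`; `card_latticeNbrs_le_six`, `exists_adj_of_mem_hexagon_succ`
(`H_{k+1} ⊆ H_k ∪ N(H_k)`); `framePt_mem_of_card_nbrs_eq_six` (a six-coordinated lattice disc has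
all six lattice neighbours present); `eq_image_hexagon_of_frame` (the induction) and
**`eq_image_hexagon_of_maximal`**: a maximal configuration of `3k(k+1)+1` discs is
`framePt t u '' H_k` for a unit `u` and a centre `t`.  Everything here is proved; no new facts
(D-0026).  Consumer: `Schmidt2013_uniqueGroundState_holds` (`StickyDiscFluctuations.lean`).
-/

noncomputable section

namespace Literature.Geometry.DiscreteGeometry

namespace Harborth

open Complex Finset
open Literature.Topology.PlaneTopology
open scoped Real

variable {P : Finset ℂ}

/-! ## §1 The frame map of a congruent copy `t + u(ℤ + ℤζ)` of the triangular lattice -/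

/-- **The frame map**: the point `t + u(m + nζ)` (`ζ = e^{iπ/3}`) of the congruent copy
`t + u(ℤ + ℤζ)` of Heitmann–Radin's triangular lattice with origin `t` and unit direction `u`,
at the label `(m, n)`. [cite: HeitmannRadin1980, §2 (p. 283) ("the points `m + n exp(iπ/3)`")] -/
def framePt (t u : ℂ) (q : ℤ × ℤ) : ℂ :=
  t + u * ((q.1 : ℂ) + (q.2 : ℂ) * Complex.exp (((π / 3 : ℝ) : ℂ) * I))

/-- Unfolding of the frame map. [cite: HeitmannRadin1980, §2 (p. 283)] -/
theorem framePt_apply (t u : ℂ) (q : ℤ × ℤ) :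
    framePt t u q = t + u * ((q.1 : ℂ) + (q.2 : ℂ) * Complex.exp (((π / 3 : ℝ) : ℂ) * I)) := rfl

/-- Differences of frame points are `u` times lattice vectors: `Φ(q) - Φ(p) = u((q-p).1 + (q-p).2 ζ)`.
[cite: HeitmannRadin1980, §2 (p. 283)] -/
theorem framePt_sub (t u : ℂ) (p q : ℤ × ℤ) :
    framePt t u q - framePt t u p =
      u * ((((q - p).1 : ℤ) : ℂ) + (((q - p).2 : ℤ) : ℂ) * Complex.exp (((π / 3 : ℝ) : ℂ) * I)) := by
  simp only [framePt, Prod.fst_sub, Prod.snd_sub]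
  push_cast
  ring

/-- `‖Φ(q) - Φ(p)‖² = N(q - p)`, the norm form `m² + mn + n²` of the label difference (`|u| = 1`).
[cite: HeitmannRadin1980, §2 (p. 283)] -/
theorem norm_framePt_sub_sq {t u : ℂ} (hu : ‖u‖ = 1) (p q : ℤ × ℤ) :
    ‖framePt t u q - framePt t u p‖ ^ 2 = ((HarborthSpiral.normForm (q - p) : ℤ) : ℝ) := by
  rw [framePt_sub, norm_mul, hu, one_mul, norm_sq_intComb]
  simp [HarborthSpiral.normForm]

/-- **Unit distance in the lattice copy is label adjacency**: `‖Φ(q) - Φ(p)‖ = 1` iff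
`N(q - p) = 1`, i.e. `HarborthSpiral.Adj p q`. [cite: HeitmannRadin1980, §2 (p. 283)] -/
theorem norm_framePt_sub_eq_one_iff {t u : ℂ} (hu : ‖u‖ = 1) (p q : ℤ × ℤ) :
    ‖framePt t u q - framePt t u p‖ = 1 ↔ HarborthSpiral.Adj p q := by
  have hsq := norm_framePt_sub_sq (t := t) hu p q
  unfold HarborthSpiral.Adj
  constructor
  · intro h
    rw [h, one_pow] at hsq
    exact_mod_cast hsq.symm
  · intro h
    rw [h] at hsq
    push_cast at hsq
    have h0 : 0 ≤ ‖framePt t u q - framePt t u p‖ := norm_nonneg _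
    nlinarith

/-- **The frame map is injective** (distinct lattice points are `≥ 1` apart).
[cite: HeitmannRadin1980, §2 (p. 283)] -/
theorem framePt_injective {t u : ℂ} (hu : ‖u‖ = 1) : Function.Injective (framePt t u) := by
  intro p q hpq
  by_contra hne
  have hne' : (q - p).1 ≠ 0 ∨ (q - p).2 ≠ 0 := by
    by_contra h
    push Not at h
    rw [Prod.fst_sub, Prod.snd_sub] at h
    exact hne (Prod.ext (by omega) (by omega))
  have h1 := one_le_norm_intComb hne'
  have h0 : framePt t u q - framePt t u p = 0 := by rw [hpq, sub_self]
  rw [framePt_sub, mul_eq_zero] at h0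
  rcases h0 with h0 | h0
  · rw [h0, norm_zero] at hu; exact zero_ne_one hu
  · rw [h0, norm_zero] at h1; exact absurd h1 (by norm_num)

/-- **Re-centring the frame**: `Φ_{t,u}(q + c) = Φ_{Φ_{t,u}(c), u}(q)`. [cite: HeitmannRadin1980, §2 (p. 283)] -/
theorem framePt_add (t u : ℂ) (c q : ℤ × ℤ) :
    framePt t u (q + c) = framePt (framePt t u c) u q := by
  simp only [framePt, Prod.fst_add, Prod.snd_add]
  push_cast
  ring

/-- Translating both labels does not change adjacency. [cite: HeitmannRadin1980, §2 (p. 283)] -/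
theorem adj_add_right_iff (p q c : ℤ × ℤ) :
    HarborthSpiral.Adj (p + c) (q + c) ↔ HarborthSpiral.Adj p q := by
  unfold HarborthSpiral.Adj
  rw [add_sub_add_right_eq_sub]

/-! ## §2 Labels: six neighbours; the hexagon `H_{k+1}` is `H_k` together with its neighbours -/

/-- A label has at most six lattice neighbours (the explicit six-point set `HarborthSpiral.nbrs`).
[cite: HeitmannRadin1980, §2 (p. 283)] -/
theorem card_latticeNbrs_le_six (q : ℤ × ℤ) : (HarborthSpiral.nbrs q).card ≤ 6 := by
  unfold HarborthSpiral.nbrs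
  refine (Finset.card_insert_le _ _).trans (Nat.succ_le_succ ?_)
  refine (Finset.card_insert_le _ _).trans (Nat.succ_le_succ ?_)
  refine (Finset.card_insert_le _ _).trans (Nat.succ_le_succ ?_)
  refine (Finset.card_insert_le _ _).trans (Nat.succ_le_succ ?_)
  refine (Finset.card_insert_le _ _).trans (Nat.succ_le_succ ?_)
  rw [Finset.card_singleton]

/-- **`H_{k+1} ⊆ H_k ∪ N(H_k)`**: every label of the hexagon of radius `k + 1` either lies in the
hexagon of radius `k` or is adjacent to one of its labels (one lattice step towards the origin).
[cite: HeitmannRadin1980, §3 (p. 283) (the hexagons `H_s`)] -/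
theorem exists_adj_of_mem_hexagon_succ {k : ℕ} {q : ℤ × ℤ}
    (hq : q ∈ HarborthSpiral.hexagon (k + 1)) :
    q ∈ HarborthSpiral.hexagon k ∨ ∃ p ∈ HarborthSpiral.hexagon k, HarborthSpiral.Adj p q := by
  obtain ⟨m, n⟩ := q
  rw [HarborthSpiral.mem_hexagon] at hq
  simp only [HarborthSpiral.Inside] at hq
  push_cast at hq
  by_cases h0 : HarborthSpiral.Inside (k : ℤ) (m, n)
  · exact Or.inl (HarborthSpiral.mem_hexagon.2 h0)
  right
  simp only [HarborthSpiral.Inside, not_and_or, not_le] at h0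
  -- one step towards the origin; six cases
  have key : ∀ p : ℤ × ℤ, HarborthSpiral.Inside (k : ℤ) p → (m, n) ∈ HarborthSpiral.nbrs p →
      ∃ p ∈ HarborthSpiral.hexagon k, HarborthSpiral.Adj p (m, n) := fun p hp hmem =>
    ⟨p, HarborthSpiral.mem_hexagon.2 hp, (HarborthSpiral.adj_iff_mem_nbrs _ _).2 hmem⟩
  by_cases h1 : 1 ≤ m ∧ 1 ≤ m + n
  · refine key (m - 1, n) ?_ ?_
    · simp only [HarborthSpiral.Inside]; omega
    · simp [HarborthSpiral.nbrs]
  by_cases h2 : m ≤ -1 ∧ m + n ≤ -1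
  · refine key (m + 1, n) ?_ ?_
    · simp only [HarborthSpiral.Inside]; omega
    · simp [HarborthSpiral.nbrs]
  by_cases h3 : 1 ≤ n ∧ 1 ≤ m + n
  · refine key (m, n - 1) ?_ ?_
    · simp only [HarborthSpiral.Inside]; omega
    · simp [HarborthSpiral.nbrs]
  by_cases h4 : n ≤ -1 ∧ m + n ≤ -1
  · refine key (m, n + 1) ?_ ?_
    · simp only [HarborthSpiral.Inside]; omega
    · simp [HarborthSpiral.nbrs]
  -- remaining: `m + n = 0`, `|m| = k + 1`
  by_cases h5 : 1 ≤ m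
  · refine key (m - 1, n + 1) ?_ ?_
    · simp only [HarborthSpiral.Inside]; omega
    · simp [HarborthSpiral.nbrs]
  · refine key (m + 1, n - 1) ?_ ?_
    · simp only [HarborthSpiral.Inside]; omega
    · simp [HarborthSpiral.nbrs]

/-! ## §3 A six-coordinated disc on the lattice has all six lattice neighbours -/

/-- **All six lattice neighbours of an interior centre are centres.** If every centre of `P` is a
point of the lattice copy `t + u(ℤ + ℤζ)` and the centre `Φ(q)` touches six others, then for
every label `q'` adjacent to `q` the lattice point `Φ(q')` is a centre: the six neighbours are
lattice points at unit distance from `Φ(q)`, and there are only six such points.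
[cite: HeitmannRadin1980, Theorem (2)(a) p. 284; Harborth1974, (2)] -/
theorem framePt_mem_of_card_nbrs_eq_six {t u : ℂ} (hu : ‖u‖ = 1)
    (hlat : ∀ p ∈ P, ∃ q : ℤ × ℤ, p = framePt t u q) {q : ℤ × ℤ} (hq : framePt t u q ∈ P)
    (h6 : (nbrs P (framePt t u q)).card = 6) {q' : ℤ × ℤ} (hadj : HarborthSpiral.Adj q q') :
    framePt t u q' ∈ P := by
  classical
  have _ := hq
  -- the neighbours are among the images of the six lattice neighbours of `q`
  have hsub : nbrs P (framePt t u q) ⊆ (HarborthSpiral.nbrs q).image (framePt t u) := by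
    intro w hw
    obtain ⟨hwP, hw1⟩ := mem_nbrs.1 hw
    obtain ⟨q'', rfl⟩ := hlat w hwP
    have hadj'' : HarborthSpiral.Adj q q'' := (norm_framePt_sub_eq_one_iff hu q q'').1 hw1
    exact Finset.mem_image.2 ⟨q'', (HarborthSpiral.adj_iff_mem_nbrs _ _).1 hadj'', rfl⟩
  have hle : ((HarborthSpiral.nbrs q).image (framePt t u)).card ≤ (nbrs P (framePt t u q)).card :=
    Finset.card_image_le.trans ((card_latticeNbrs_le_six q).trans h6.ge)
  have heq := Finset.eq_of_subset_of_card_le hsub hle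
  have hmem : framePt t u q' ∈ nbrs P (framePt t u q) := by
    rw [heq]
    exact Finset.mem_image.2 ⟨q', (HarborthSpiral.adj_iff_mem_nbrs _ _).1 hadj, rfl⟩
  exact (mem_nbrs.1 hmem).1

/-! ## §4 The induction on the hexagonal radius -/

/-- `√(12(3s² + 3s + 1) - 3) = 6s + 3`: at the centred hexagonal numbers `12n - 3` is a perfect
square. [cite: HeitmannRadin1980, §3 (2)] -/
theorem sqrt_twelve_mul_hexagonal (s : ℕ) :
    Real.sqrt (12 * ((3 * s * (s + 1) + 1 : ℕ) : ℝ) - 3) = 6 * s + 3 := by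
  have hs : (0 : ℝ) ≤ 6 * s + 3 := by positivity
  have hsq : (12 * ((3 * s * (s + 1) + 1 : ℕ) : ℝ) - 3) = (6 * s + 3) ^ 2 := by
    push_cast; ring
  rw [hsq, Real.sqrt_sq hs]

/-- Harborth's number at `n = 3s(s+1) + 1` is `9s² + 3s` (the complete hexagon `H_s`).
[cite: HeitmannRadin1980, §3 (2)] -/
theorem harborthNumber_hexagonal' (s : ℕ) :
    harborthNumber (3 * s * (s + 1) + 1) = 9 * s ^ 2 + 3 * s := by
  rw [show 3 * s * (s + 1) + 1 = 3 * s ^ 2 + 3 * s + 1 by ring]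
  exact harborthNumber_hexagonal s

/-- **The induction** (module docstring).  A maximal configuration of `3k(k+1) + 1` unit discs
all of whose centres lie on the lattice copy `t + u(ℤ + ℤζ)` is the image of a translate
`H_k + c` of the lattice hexagon under the frame map: the interior configuration is maximal with
`3(k-1)k + 1` discs, hence `Φ(H_{k-1} + c)` by induction, and the six lattice neighbours of each
of its discs are centres, which fills `Φ(H_k + c)`. [cite: Schmidt2013, Proposition 2.7]
[cite: HeitmannRadin1980, Theorem (2)(a)–(b) p. 284] -/
theorem eq_image_hexagon_of_frame :
    ∀ (k : ℕ) (P : Finset ℂ), IsHard P → P.card = 3 * k * (k + 1) + 1 →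
      2 * harborthNumber P.card ≤ ((darts P).card : ℤ) → ∀ t u : ℂ, ‖u‖ = 1 →
      (∀ p ∈ P, ∃ q : ℤ × ℤ, p = framePt t u q) →
      ∃ c : ℤ × ℤ, P = (HarborthSpiral.hexagon k).image fun q => framePt t u (q + c) := by
  intro k
  induction k with
  | zero =>
    intro P _ hcard _ t u _ hlat
    classical
    obtain ⟨p, rfl⟩ := Finset.card_eq_one.1 (by simpa using hcard)
    obtain ⟨c, hc⟩ := hlat p (Finset.mem_singleton_self p)
    refine ⟨c, ?_⟩
    rw [HarborthSpiral.hexagon_zero, Finset.image_singleton, hc,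
      show ((0 : ℤ), (0 : ℤ)) + c = c from Prod.ext (by simp) (by simp)]
  | succ k ih =>
    intro P hP hcard hmax t u hu hlat
    classical
    -- sizes
    have hk1 : 1 ≤ (k + 1) * (k + 2) := Nat.one_le_iff_ne_zero.2 (by positivity)
    have h3 : 3 ≤ P.card := by
      rw [hcard]
      have : 3 * (k + 1) * (k + 1 + 1) = 3 * ((k + 1) * (k + 2)) := by ring
      omega
    have hns : ¬ Splits P := not_splits_of_maximal hP hmax
    have hne : P.Nonempty := Finset.card_pos.1 (by omega)
    have h2 : ∀ p ∈ P, 2 ≤ (nbrs P p).card := fun p hp => two_le_card_nbrs_of_not_splits h3 hns hp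
    have ht := tight_or_outer_of_maximal P.card P hP rfl h3 hmax hne h2
    set S := bdrySet P hne h2 with hS
    have hSP : S ⊆ P := bdrySet_subset
    -- `a = 6(k+1)`
    have hScard : (S.card : ℤ) = 6 * (k + 1) := by
      have h := card_bdrySet_of_maximal (hne := hne) (h2 := h2) hP h3 hmax
      rw [← hS, hcard, sqrt_twelve_mul_hexagonal (k + 1)] at h
      have e : ((6 : ℝ) * ((k + 1 : ℕ) : ℝ) + 3) = ((6 * ((k : ℤ) + 1) + 3 : ℤ) : ℝ) := by
        push_cast; ring
      rw [e, Int.ceil_intCast] at h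
      omega
    -- Harborth's bookkeeping and the equality `σ_S = 4a - 6`
    obtain ⟨-, haP, -, hbook, hDS, -, -, -, hcardP'⟩ :=
      boundary_bookkeeping (hne := hne) (h2 := h2) hP hns
    rw [← hS] at haP hbook hDS hcardP'
    have hσ := sum_card_nbrs_bdrySet_eq_of_tight (hne := hne) (h2 := h2) hP hns ht
    rw [← hS] at hσ
    -- the interior configuration is maximal with `3k(k+1) + 1` discs
    have hcardP'2 : (P \ S).card = 3 * k * (k + 1) + 1 := by
      have h1 : ((P \ S).card : ℤ) = P.card - S.card := by
        rw [hcardP', Nat.cast_sub haP]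
      have h2' : ((P \ S).card : ℤ) = ((3 * k * (k + 1) + 1 : ℕ) : ℤ) := by
        rw [h1, hcard, hScard]; push_cast; ring
      exact_mod_cast h2'
    have hBn : harborthNumber P.card = 9 * ((k : ℤ) + 1) ^ 2 + 3 * (k + 1) := by
      rw [hcard]
      have := harborthNumber_hexagonal' (k + 1)
      push_cast at this
      exact this
    have hBn' : harborthNumber (P \ S).card = 9 * (k : ℤ) ^ 2 + 3 * k := by
      rw [hcardP'2]
      exact_mod_cast harborthNumber_hexagonal' k
    have hmax' : 2 * harborthNumber (P \ S).card ≤ ((darts (P \ S)).card : ℤ) := by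
      rw [hBn']
      rw [hBn] at hmax
      nlinarith [hbook, hDS, hσ, hScard, hmax]
    have hP' : IsHard (P \ S) := hP.mono Finset.sdiff_subset
    have hlat' : ∀ p ∈ P \ S, ∃ q : ℤ × ℤ, p = framePt t u q := fun p hp =>
      hlat p (Finset.sdiff_subset hp)
    obtain ⟨c, hc⟩ := ih (P \ S) hP' hcardP'2 hmax' t u hu hlat'
    -- interior discs touch six others
    have h6 : ∀ v ∈ P \ S, (nbrs P v).card = 6 := fun v hv =>
      card_nbrs_eq_six_of_tight (hne := hne) (h2 := h2) hP ht (Finset.mem_sdiff.1 hv).1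
        (Finset.mem_sdiff.1 hv).2
    -- the big hexagon lies in `P`
    have hsub : (HarborthSpiral.hexagon (k + 1)).image (fun q => framePt t u (q + c)) ⊆ P := by
      intro x hx
      obtain ⟨q, hq, rfl⟩ := Finset.mem_image.1 hx
      rcases exists_adj_of_mem_hexagon_succ hq with hq' | ⟨p, hp, hadj⟩
      · have hmem : framePt t u (q + c) ∈ P \ S := by
          rw [hc]; exact Finset.mem_image_of_mem _ hq'
        exact Finset.sdiff_subset hmem
      · have hpP' : framePt t u (p + c) ∈ P \ S := by
          rw [hc]; exact Finset.mem_image_of_mem _ hp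
        exact framePt_mem_of_card_nbrs_eq_six hu hlat (Finset.sdiff_subset hpP') (h6 _ hpP')
          ((adj_add_right_iff p q c).2 hadj)
    -- and has as many points as `P`
    have hinj : Function.Injective fun q : ℤ × ℤ => framePt t u (q + c) :=
      (framePt_injective (t := t) hu).comp (add_left_injective c)
    have hcardimg : ((HarborthSpiral.hexagon (k + 1)).image fun q => framePt t u (q + c)).card =
        P.card := by
      rw [Finset.card_image_of_injective _ hinj, (HarborthSpiral.count_hexagon (k + 1)).1, hcard]
      ring
    exact ⟨c, (Finset.eq_of_subset_of_card_le hsub hcardimg.ge).symm⟩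

/-! ## §5 The theorem -/

/-- **A maximal configuration of `3k(k+1) + 1` unit discs is a regular lattice hexagon.**  If a
hard configuration `P ⊂ ℂ` of `n = 3k(k+1) + 1` unit(-diameter) discs has at least — hence
exactly — `[3n - √(12n-3)] = 9k² + 3k` contact pairs (a ground state of `n` sticky discs), then
`P = {t + u(m + nζ) : |m|, |n|, |m+n| ≤ k}` for some centre `t` and unit `u`: the lattice points
of a regular hexagon of side `k`, `𝓛 ∩ conv(B₁^{(k)},…,B₆^{(k)})` up to a rigid motion.  Frame
from Theorem (2)(a) (`exists_lattice_of_tight`), then `eq_image_hexagon_of_frame`.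
[cite: Schmidt2013, Proposition 2.7] [cite: HeitmannRadin1980, Theorem (2)(a)–(b) p. 284] -/
theorem eq_image_hexagon_of_maximal (hP : IsHard P) {k : ℕ} (hcard : P.card = 3 * k * (k + 1) + 1)
    (hmax : 2 * harborthNumber P.card ≤ ((darts P).card : ℤ)) :
    ∃ t u : ℂ, ‖u‖ = 1 ∧ P = (HarborthSpiral.hexagon k).image (framePt t u) := by
  classical
  -- a lattice frame containing `P`
  obtain ⟨t, u, hu, hlat⟩ : ∃ t u : ℂ, ‖u‖ = 1 ∧ ∀ p ∈ P, ∃ q : ℤ × ℤ, p = framePt t u q := by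
    rcases Nat.eq_zero_or_pos k with rfl | hk
    · obtain ⟨p, rfl⟩ := Finset.card_eq_one.1 (by simpa using hcard)
      refine ⟨p, 1, norm_one, fun p' hp' => ⟨(0, 0), ?_⟩⟩
      rw [Finset.mem_singleton.1 hp']
      simp [framePt]
    · have hk1 : 1 ≤ k * (k + 1) := Nat.one_le_iff_ne_zero.2 (by positivity)
      have h3 : 3 ≤ P.card := by
        rw [hcard]
        have : 3 * k * (k + 1) = 3 * (k * (k + 1)) := by ring
        omega
      have hns : ¬ Splits P := not_splits_of_maximal hP hmax
      have hne : P.Nonempty := Finset.card_pos.1 (by omega)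
      have h2 : ∀ p ∈ P, 2 ≤ (nbrs P p).card := fun p hp =>
        two_le_card_nbrs_of_not_splits h3 hns hp
      have ht := tight_or_outer_of_maximal P.card P hP rfl h3 hmax hne h2
      obtain ⟨u, t, hu, hlat⟩ := exists_lattice_of_tight hP hns ht
      exact ⟨t, u, hu, fun p hp => by
        obtain ⟨a, b, hab⟩ := hlat p hp
        exact ⟨(a, b), hab⟩⟩
  obtain ⟨c, hc⟩ := eq_image_hexagon_of_frame k P hP hcard hmax t u hu hlat
  refine ⟨framePt t u c, u, hu, ?_⟩
  rw [hc]
  exact Finset.image_congr fun q _ => framePt_add t u c q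

end Harborth

end Literature.Geometry.DiscreteGeometry

end
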